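import Summits.PneNP.PneNP.Theses.KarlinRubin
import Literature.Computability.Complexity.CircuitClassesProofs
import Literature.Computability.Complexity.PseudoComplementCircuits
import Literature.Computability.Complexity.RossmanMonotoneCliqueThm2Proofs

/-!
# Crux `MonotoneSuffices` (stmt-PneNP-18026), line `Sketch` — second rung, partial: ONE negation
gate is free unless its argument is a two-sided coin

A detector with exactly one negation gate has the form `f(x) = F(x, ¬g(x))` with `F` monotone in the
wire (`F(x,0) ≤ F(x,1)`; for a `{∧₂,∨₂,0,1}`-circuit `D` on the inputs plus one extra wire,
`F(x,b) = D(x,b)`) and `g` monotone. Dropping the negation to a CONSTANT costs nothing in size and,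
at the level of arbitrary functions (no monotonicity needed for the inequalities),

* `oneNeg_errSum_true_le`:  `errSum(F(·,1)) ≤ errSum(f) + μ₀{g = 1}`,
* `oneNeg_errSum_false_le`: `errSum(F(·,0)) ≤ errSum(f) + μ₁{g = 0}`,

so `min(errSum F(·,1), errSum F(·,0)) ≤ errSum(f) + min(μ₀{g = 1}, μ₁{g = 0})`
(`oneNeg_min_errSum_le`): the negation is eliminable for free unless `g` is a COIN UNDER BOTH LAWS —
non-negligible under `G(n,1/2)` and non-full under the planted law. For monotone `g` the two masses are
ordered, `μ₀{g = 1} ≤ μ₁{g = 1}` (`null_true_le_planted_true`: planting only adds edges), so the residue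
is a genuinely two-sided coin `c ≤ μ₀{g=1} ≤ μ₁{g=1} ≤ 1 - c`. This is the idea card
`density-shift-elimination`'s residue (R2) ("`S_n`-invariant coarse coins"), reached here from the
error-sum bookkeeping alone, and it is where every known `δ = 0` detector lives (centred statistics).
The rung in the crux's format: `stub_oneNegation` — a one-negation `{∧₂,∨₂,0,1}`-family whose negated
gate is asymptotically NOT a two-sided coin (`min(μ₀{gₙ = 1}, μ₁{gₙ = 0}) → 0`) is simulated by a
monotone family of size `≤ s n + 1` with error sum `→ 0`.
-/

set_option linter.dupNamespace false -- `Summit.PneNP.PneNP.…`: summit = sub-problem name (D-0017)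

namespace Summit.PneNP.PneNP.Theorems.MonotoneSuffices.Compression

open Literature.Computability.Complexity Literature.Probability.RandomGraphs.PlantedClique Filter Finset
open scoped ENNReal

/-! ### Function level: dropping the negation of a non-coin is free -/

/-- **Freezing the negated wire to `1`.** For `f(x) = F(x, ¬g(x))` with `F(x,0) ≤ F(x,1)`:
`errSum(F(·,1)) ≤ errSum(f) + μ₀{g = 1}` — under the null law `{F(·,1) = 1} ⊆ {f = 1} ∪ {g = 1}`,
under the planted law `{F(·,1) = 0} ⊆ {f = 0}`. [folklore] -/
theorem oneNeg_errSum_true_le (n k : ℕ) (F : EdgeVec n → Bool → Bool) (g : EdgeVec n → Bool)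
    (hF : ∀ x, F x false ≤ F x true) :
    (erdosRenyiHalf n).toOuterMeasure {x | F x true = true} +
        (plantedCliqueDist n k).toOuterMeasure {x | F x true = false} ≤
      ((erdosRenyiHalf n).toOuterMeasure {x | F x (!g x) = true} +
          (plantedCliqueDist n k).toOuterMeasure {x | F x (!g x) = false}) +
        (erdosRenyiHalf n).toOuterMeasure {x | g x = true} := by
  have h0 : (erdosRenyiHalf n).toOuterMeasure {x | F x true = true} ≤
      (erdosRenyiHalf n).toOuterMeasure {x | F x (!g x) = true} +
        (erdosRenyiHalf n).toOuterMeasure {x | g x = true} :=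
    calc (erdosRenyiHalf n).toOuterMeasure {x | F x true = true}
        ≤ (erdosRenyiHalf n).toOuterMeasure ({x | F x (!g x) = true} ∪ {x | g x = true}) := by
          refine MeasureTheory.measure_mono fun x hx => ?_
          simp only [Set.mem_setOf_eq, Set.mem_union] at hx ⊢
          cases hg : g x
          · left; simpa using hx
          · right; rfl
      _ ≤ _ := MeasureTheory.measure_union_le _ _
  have h1 : (plantedCliqueDist n k).toOuterMeasure {x | F x true = false} ≤
      (plantedCliqueDist n k).toOuterMeasure {x | F x (!g x) = false} := by
    refine MeasureTheory.measure_mono fun x hx => ?_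
    simp only [Set.mem_setOf_eq] at hx ⊢
    cases hg : g x
    · simpa using hx
    · have hle := hF x
      rw [hx] at hle
      cases h' : F x false with
      | false => simpa using h'
      | true => rw [h'] at hle; exact absurd hle (by decide)
  calc _ ≤ ((erdosRenyiHalf n).toOuterMeasure {x | F x (!g x) = true} +
        (erdosRenyiHalf n).toOuterMeasure {x | g x = true}) +
          (plantedCliqueDist n k).toOuterMeasure {x | F x (!g x) = false} := add_le_add h0 h1
    _ = _ := by ring

/-- **Freezing the negated wire to `0`.** For `f(x) = F(x, ¬g(x))` with `F(x,0) ≤ F(x,1)`: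
`errSum(F(·,0)) ≤ errSum(f) + μ₁{g = 0}` — under the null law `{F(·,0) = 1} ⊆ {f = 1}`, under the
planted law `{F(·,0) = 0} ⊆ {f = 0} ∪ {g = 0}`. [folklore] -/
theorem oneNeg_errSum_false_le (n k : ℕ) (F : EdgeVec n → Bool → Bool) (g : EdgeVec n → Bool)
    (hF : ∀ x, F x false ≤ F x true) :
    (erdosRenyiHalf n).toOuterMeasure {x | F x false = true} +
        (plantedCliqueDist n k).toOuterMeasure {x | F x false = false} ≤
      ((erdosRenyiHalf n).toOuterMeasure {x | F x (!g x) = true} +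
          (plantedCliqueDist n k).toOuterMeasure {x | F x (!g x) = false}) +
        (plantedCliqueDist n k).toOuterMeasure {x | g x = false} := by
  have h0 : (erdosRenyiHalf n).toOuterMeasure {x | F x false = true} ≤
      (erdosRenyiHalf n).toOuterMeasure {x | F x (!g x) = true} := by
    refine MeasureTheory.measure_mono fun x hx => ?_
    simp only [Set.mem_setOf_eq] at hx ⊢
    cases hg : g x
    · have hle := hF x
      rw [hx] at hle
      cases h' : F x true with
      | true => simpa using h'
      | false => rw [h'] at hle; exact absurd hle (by decide)
    · simpa using hx
  have h1 : (plantedCliqueDist n k).toOuterMeasure {x | F x false = false} ≤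
      (plantedCliqueDist n k).toOuterMeasure {x | F x (!g x) = false} +
        (plantedCliqueDist n k).toOuterMeasure {x | g x = false} :=
    calc (plantedCliqueDist n k).toOuterMeasure {x | F x false = false}
        ≤ (plantedCliqueDist n k).toOuterMeasure ({x | F x (!g x) = false} ∪ {x | g x = false}) := by
          refine MeasureTheory.measure_mono fun x hx => ?_
          simp only [Set.mem_setOf_eq, Set.mem_union] at hx ⊢
          cases hg : g x
          · right; rfl
          · left; simpa using hx
      _ ≤ _ := MeasureTheory.measure_union_le _ _
  calc _ ≤ (erdosRenyiHalf n).toOuterMeasure {x | F x (!g x) = true} +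
        ((plantedCliqueDist n k).toOuterMeasure {x | F x (!g x) = false} +
          (plantedCliqueDist n k).toOuterMeasure {x | g x = false}) := add_le_add h0 h1
    _ = _ := by ring

/-- **One negation is free unless its argument is a two-sided coin.** For `f(x) = F(x, ¬g(x))` with
`F(x,0) ≤ F(x,1)`, one of the two negation-free tests `F(·,1)`, `F(·,0)` has error sum at most
`errSum(f) + min(μ₀{g = 1}, μ₁{g = 0})`. [folklore] -/
theorem oneNeg_min_errSum_le (n k : ℕ) (F : EdgeVec n → Bool → Bool) (g : EdgeVec n → Bool)
    (hF : ∀ x, F x false ≤ F x true) :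
    min ((erdosRenyiHalf n).toOuterMeasure {x | F x true = true} +
          (plantedCliqueDist n k).toOuterMeasure {x | F x true = false})
        ((erdosRenyiHalf n).toOuterMeasure {x | F x false = true} +
          (plantedCliqueDist n k).toOuterMeasure {x | F x false = false}) ≤
      ((erdosRenyiHalf n).toOuterMeasure {x | F x (!g x) = true} +
          (plantedCliqueDist n k).toOuterMeasure {x | F x (!g x) = false}) +
        min ((erdosRenyiHalf n).toOuterMeasure {x | g x = true})
          ((plantedCliqueDist n k).toOuterMeasure {x | g x = false}) := by
  rcases le_total ((erdosRenyiHalf n).toOuterMeasure {x | g x = true})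
      ((plantedCliqueDist n k).toOuterMeasure {x | g x = false}) with h | h
  · rw [min_eq_left h]
    exact (min_le_left _ _).trans (oneNeg_errSum_true_le n k F g hF)
  · rw [min_eq_right h]
    exact (min_le_right _ _).trans (oneNeg_errSum_false_le n k F g hF)

/-! ### For monotone `g` the residue is a coin under both laws -/

/-- **Planting only raises monotone events**: for monotone `g`, `μ₀{g = 1} ≤ μ₁{g = 1}` — the planted
law is the image of `G(n,1/2)` under `plant S` (averaged over `S`), and `x ≤ plant S x`. Hence in the
residual case of `oneNeg_min_errSum_le` the negated gate is a two-sided coin: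
`c ≤ μ₀{g = 1} ≤ μ₁{g = 1} ≤ 1 - c`. [folklore] -/
theorem null_true_le_planted_true (n k : ℕ) (g : EdgeVec n → Bool) (hg : Monotone g) :
    (erdosRenyiHalf n).toOuterMeasure {x | g x = true} ≤
      (plantedCliqueDist n k).toOuterMeasure {x | g x = true} := by
  classical
  set u := PMF.uniformOfFinset (kSubsets n k) (kSubsets_nonempty n k) with hu
  have h1 : (plantedCliqueDist n k).toOuterMeasure {x | g x = true} =
      ∑' S, u S * (erdosRenyiHalf n).toOuterMeasure {x | g (plant S x) = true} := by
    rw [plantedCliqueDist, PMF.toOuterMeasure_map_apply, plantedCliqueJoint,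
      PMF.toOuterMeasure_bind_apply]
    refine tsum_congr fun S => ?_
    rw [PMF.toOuterMeasure_map_apply]
    rfl
  have h2 : ∀ S, u S * (erdosRenyiHalf n).toOuterMeasure {x | g x = true} ≤
      u S * (erdosRenyiHalf n).toOuterMeasure {x | g (plant S x) = true} := fun S => by
    refine mul_le_mul_right (MeasureTheory.measure_mono fun x hx => ?_) _
    simp only [Set.mem_setOf_eq] at hx ⊢
    have hle : g x ≤ g (plant S x) := hg (fun e => le_plant S x e)
    rw [hx] at hle
    exact Bool.eq_true_of_true_le hle
  calc (erdosRenyiHalf n).toOuterMeasure {x | g x = true}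
      = ∑' S, u S * (erdosRenyiHalf n).toOuterMeasure {x | g x = true} := by
        rw [ENNReal.tsum_mul_right, PMF.tsum_coe, one_mul]
    _ ≤ ∑' S, u S * (erdosRenyiHalf n).toOuterMeasure {x | g (plant S x) = true} :=
        ENNReal.tsum_le_tsum h2
    _ = _ := h1.symm

/-! ### The rung in the crux's format -/

/-- **`MonotoneSuffices` for one negation gate that is not a two-sided coin.** Let a detector family be
given by `{∧₂,∨₂,0,1}`-circuits `D n` on the edge variables plus ONE extra wire, of size `≤ s n`, read
at the wire value `¬(g n)(x)` for `{∧₂,∨₂,0,1}`-circuits `g n` (a circuit with exactly one negation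
gate). If its error sum at clique size `k n` tends to `0` and the negated gate is asymptotically not a
two-sided coin, `min(μ₀{g n = 1}, μ₁{g n = 0}) → 0`, then freezing the wire to the better constant gives
`{∧₂,∨₂,0,1}`-circuits of size `≤ s n + 1` with error sum `→ 0` (`oneNeg_min_errSum_le`). The
residual case — `g n` a coin under both laws, `μ₀ ≤ μ₁` by `null_true_le_planted_true` — is the open
part of the second rung. [folklore] -/
theorem stub_oneNegation :
    ∀ (k s : ℕ → ℕ)
      (D : (n : ℕ) → Circuit ((⊤ : SimpleGraph (Fin n)).edgeSet ⊕ Unit))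
      (g : (n : ℕ) → Circuit ((⊤ : SimpleGraph (Fin n)).edgeSet)),
      (∀ᶠ n : ℕ in atTop, (D n).IsOver monotoneBasis01 ∧ (g n).IsOver monotoneBasis01 ∧ (D n).size ≤ s n) →
      Tendsto (fun n : ℕ =>
          (erdosRenyiHalf n).toOuterMeasure
              {x | (D n).eval (Sum.elim x (fun _ => !((g n).eval x))) = true} +
            (plantedCliqueDist n (k n)).toOuterMeasure
              {x | (D n).eval (Sum.elim x (fun _ => !((g n).eval x))) = false})
        atTop (nhds 0) →
      Tendsto (fun n : ℕ => min ((erdosRenyiHalf n).toOuterMeasure {x | (g n).eval x = true})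
          ((plantedCliqueDist n (k n)).toOuterMeasure {x | (g n).eval x = false})) atTop (nhds 0) →
      ∃ M : (n : ℕ) → Circuit ((⊤ : SimpleGraph (Fin n)).edgeSet),
        (∀ᶠ n : ℕ in atTop, (M n).IsOver monotoneBasis01 ∧ (M n).size ≤ s n + 1) ∧
        Tendsto (fun n : ℕ => (erdosRenyiHalf n).toOuterMeasure {x | (M n).eval x = true} +
            (plantedCliqueDist n (k n)).toOuterMeasure {x | (M n).eval x = false}) atTop (nhds 0) := by
  intro k s D g hD herr hcoin
  classical
  -- freezing the extra wire of `D n` to a constant `b` is a `{∧₂,∨₂,0,1}`-circuit of size `≤ |D n| + 1`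
  have hfreeze : ∀ (n : ℕ), (D n).IsOver monotoneBasis01 → ∀ b : Bool,
      ∃ C : Circuit ((⊤ : SimpleGraph (Fin n)).edgeSet), C.IsOver monotoneBasis01 ∧
        C.size ≤ (D n).size + 1 ∧ ∀ x, C.eval x = (D n).eval (Sum.elim x (fun _ => b)) := by
    intro n hDn b
    have h1 : CktSize monotoneBasis01 (fun (x : EdgeVec n) => Sum.elim x (fun (_ : Unit) => b)) (0 + 1) :=
      (CktSize.id monotoneBasis01).pair (cktSize_const_mono01 _ b)
    have h2 := h1.comp ((D n).cktSize_eval hDn)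
    obtain ⟨C, hC, hsize, hev⟩ := h2.toCircuit
    exact ⟨C, hC, by omega, fun x => hev x⟩
  -- pointwise in `n`: the better of the two frozen circuits
  have hex : ∀ n : ℕ, (D n).IsOver monotoneBasis01 →
      ∃ M : Circuit ((⊤ : SimpleGraph (Fin n)).edgeSet), M.IsOver monotoneBasis01 ∧
        M.size ≤ (D n).size + 1 ∧
        (erdosRenyiHalf n).toOuterMeasure {x | M.eval x = true} +
            (plantedCliqueDist n (k n)).toOuterMeasure {x | M.eval x = false} ≤
          ((erdosRenyiHalf n).toOuterMeasure
                {x | (D n).eval (Sum.elim x (fun _ => !((g n).eval x))) = true} +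
              (plantedCliqueDist n (k n)).toOuterMeasure
                {x | (D n).eval (Sum.elim x (fun _ => !((g n).eval x))) = false}) +
            min ((erdosRenyiHalf n).toOuterMeasure {x | (g n).eval x = true})
              ((plantedCliqueDist n (k n)).toOuterMeasure {x | (g n).eval x = false}) := by
    intro n hDn
    -- `F x b = D(x, b)` is monotone in the wire
    have hmono : Monotone (D n).eval := (D n).monotone_eval_of_isOver_monotoneBasis01 hDn
    have hF : ∀ x : EdgeVec n, (D n).eval (Sum.elim x (fun _ => false)) ≤ (D n).eval (Sum.elim x (fun _ => true)) :=
      fun x => hmono (fun w => by rcases w with i | u <;> simp)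
    have hmin := oneNeg_min_errSum_le n (k n) (fun x b => (D n).eval (Sum.elim x (fun _ => b))) (g n).eval hF
    rcases le_total
        ((erdosRenyiHalf n).toOuterMeasure {x | (D n).eval (Sum.elim x (fun _ => true)) = true} +
          (plantedCliqueDist n (k n)).toOuterMeasure {x | (D n).eval (Sum.elim x (fun _ => true)) = false})
        ((erdosRenyiHalf n).toOuterMeasure {x | (D n).eval (Sum.elim x (fun _ => false)) = true} +
          (plantedCliqueDist n (k n)).toOuterMeasure {x | (D n).eval (Sum.elim x (fun _ => false)) = false})
      with hle | hle
    · obtain ⟨C, hC, hsize, hev⟩ := hfreeze n hDn true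
      refine ⟨C, hC, hsize, ?_⟩
      have e1 : {x | C.eval x = true} = {x | (D n).eval (Sum.elim x (fun _ => true)) = true} := by
        ext x; simp [hev x]
      have e2 : {x | C.eval x = false} = {x | (D n).eval (Sum.elim x (fun _ => true)) = false} := by
        ext x; simp [hev x]
      rw [e1, e2]
      rw [min_eq_left hle] at hmin
      exact hmin
    · obtain ⟨C, hC, hsize, hev⟩ := hfreeze n hDn false
      refine ⟨C, hC, hsize, ?_⟩
      have e1 : {x | C.eval x = true} = {x | (D n).eval (Sum.elim x (fun _ => false)) = true} := by
        ext x; simp [hev x]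
      have e2 : {x | C.eval x = false} = {x | (D n).eval (Sum.elim x (fun _ => false)) = false} := by
        ext x; simp [hev x]
      rw [e1, e2]
      rw [min_eq_right hle] at hmin
      exact hmin
  let M : (n : ℕ) → Circuit ((⊤ : SimpleGraph (Fin n)).edgeSet) := fun n =>
    if h : (D n).IsOver monotoneBasis01 then (hex n h).choose else Circuit.const _ false
  have hMspec : ∀ᶠ n : ℕ in atTop, (M n).IsOver monotoneBasis01 ∧ (M n).size ≤ s n + 1 ∧
      (erdosRenyiHalf n).toOuterMeasure {x | (M n).eval x = true} +
          (plantedCliqueDist n (k n)).toOuterMeasure {x | (M n).eval x = false} ≤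
        ((erdosRenyiHalf n).toOuterMeasure
              {x | (D n).eval (Sum.elim x (fun _ => !((g n).eval x))) = true} +
            (plantedCliqueDist n (k n)).toOuterMeasure
              {x | (D n).eval (Sum.elim x (fun _ => !((g n).eval x))) = false}) +
          min ((erdosRenyiHalf n).toOuterMeasure {x | (g n).eval x = true})
            ((plantedCliqueDist n (k n)).toOuterMeasure {x | (g n).eval x = false}) := by
    filter_upwards [hD] with n hn
    have hMn : M n = (hex n hn.1).choose := dif_pos hn.1
    obtain ⟨hB, hsize, herrn⟩ := (hex n hn.1).choose_spec
    rw [hMn]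
    exact ⟨hB, hsize.trans (Nat.add_le_add_right hn.2.2 1), herrn⟩
  refine ⟨M, hMspec.mono fun n h => ⟨h.1, h.2.1⟩, ?_⟩
  have hsum := herr.add hcoin
  rw [add_zero] at hsum
  exact tendsto_of_tendsto_of_tendsto_of_le_of_le' tendsto_const_nhds hsum
    (Eventually.of_forall fun _ => bot_le) (hMspec.mono fun n h => h.2.2)

end Summit.PneNP.PneNP.Theorems.MonotoneSuffices.Compression
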